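import Literature.RepresentationTheory.CompactGroups.PointDerivations
import HarnessLib

/-!
# Left-invariant derivations of the representative functions and the bracket of point derivations

Continuation of `PointDerivations`. For a linear functional `δ` on `C(G, ℝ)` and a
translation-finite `u` the functions

* `leftDeriv δ u : x ↦ δ(u(x ·))` ("`δ` applied along right-multiplication curves", the
  left-invariant vector field of `δ`) and
* `rightDeriv δ u : x ↦ δ(u(· x))` (the right-invariant one)

are again translation-finite: from the finite expansion `u(xz) = Σ u(x yᵢ) wᵢ(z)`,
`leftDeriv δ u = Σ δ(wᵢ) · u(· yᵢ) ∈ biSpan u` (`leftDeriv_eq_sum`). We prove: linearity on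
`R = translationFinite G`; `leftDeriv δ u (1) = δ u`; **left invariance**
(`leftDeriv δ (lTrans g u) = lTrans g (leftDeriv δ u)`); the **Leibniz rule** for point derivations;
the inversion relation `rightDeriv δ u = -(leftDeriv δ ǔ)ˇ` (`δ` a point derivation, from
`δ(ǔ) = -δ(u)`); the **"Fubini" identity** `δ₂ (rightDeriv δ₁ u) = δ₁ (leftDeriv δ₂ u)` for any two
functionals (both equal `Σ δ₁(u(· yᵢ)) δ₂(wᵢ)`), whence left and right derivations commute; and the
**bracket** `⁅δ₁, δ₂⁆ (u) = δ₁ (leftDeriv δ₂ u) - δ₂ (leftDeriv δ₁ u)` of two point derivations,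
again a point derivation, with `leftDeriv ⁅δ₁, δ₂⁆ = [leftDeriv δ₁, leftDeriv δ₂]` on `R`.

This is the (Lie-free) Lie algebra of a topological group seen through its Hopf algebra of
representative functions (Hochschild, *The Structure of Lie Groups* (1965), Ch. II; Bröcker–tom
Dieck (1985) III §1), used for the heat-kernel uniqueness theorem
`Literature.MathematicalPhysics.QuantumLattice.isGroupHeatKernel_unique_up_to_scale`. Values of the
operators on non-representative functions are junk (`0`). No named facts.
-/

noncomputable section

open scoped Classical

namespace Literature.RepresentationTheory.CompactGroups

variable {G : Type*} [TopologicalSpace G] [Group G] [IsTopologicalGroup G]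

/-! ### The left- and right-invariant derivations attached to a functional -/

/-- **Expansion of the left translates**: for translation-finite `u` there are `yᵢ`, `wᵢ ∈ biSpan u`
with `u(x ·) = Σᵢ u(x yᵢ) wᵢ` as continuous functions. [folklore] -/
theorem IsTranslationFinite.exists_lTrans_eq_sum {u : C(G, ℝ)} (hu : IsTranslationFinite u) :
    ∃ (s : Finset G) (w : G → C(G, ℝ)), (∀ y, w y ∈ biSpan u) ∧
      ∀ x, lTrans x u = ∑ y ∈ s, (u (x * y)) • w y := by
  obtain ⟨s, w, hw, h⟩ := hu.exists_expansion
  refine ⟨s, w, hw, fun x => ?_⟩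
  ext z
  simp [h x z]

/-- **Expansion of the right translates**: `u(· x) = Σᵢ wᵢ(x) u(· yᵢ)`. [folklore] -/
theorem IsTranslationFinite.exists_rTrans_eq_sum {u : C(G, ℝ)} (hu : IsTranslationFinite u) :
    ∃ (s : Finset G) (w : G → C(G, ℝ)), (∀ y, w y ∈ biSpan u) ∧
      ∀ x, rTrans x u = ∑ y ∈ s, (w y x) • rTrans y u := by
  obtain ⟨s, w, hw, h⟩ := hu.exists_expansion
  refine ⟨s, w, hw, fun x => ?_⟩
  ext z
  simp [h z x, mul_comm]

/-- The left-invariant derivation of a functional `δ`: `(leftDeriv δ u)(x) = δ(u(x ·))` for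
translation-finite `u` (junk value `0` otherwise). For a point derivation `δ` this is the
left-invariant vector field with value `δ` at `1` applied to `u` (Hochschild 1965, II §3). [folklore] -/
def leftDeriv (δ : C(G, ℝ) →ₗ[ℝ] ℝ) (u : C(G, ℝ)) : C(G, ℝ) :=
  if hu : IsTranslationFinite u then
    ∑ y ∈ (hu.exists_lTrans_eq_sum).choose,
      δ ((hu.exists_lTrans_eq_sum).choose_spec.choose y) • rTrans y u
  else 0

/-- The right-invariant derivation of a functional `δ`: `(rightDeriv δ u)(x) = δ(u(· x))` for
translation-finite `u` (junk value `0` otherwise). [folklore] -/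
def rightDeriv (δ : C(G, ℝ) →ₗ[ℝ] ℝ) (u : C(G, ℝ)) : C(G, ℝ) :=
  if hu : IsTranslationFinite u then
    ∑ y ∈ (hu.exists_rTrans_eq_sum).choose,
      δ (rTrans y u) • (hu.exists_rTrans_eq_sum).choose_spec.choose y
  else 0

variable (δ : C(G, ℝ) →ₗ[ℝ] ℝ)

/-- `(leftDeriv δ u)(x) = δ(u(x ·))`. [folklore] -/
theorem leftDeriv_apply {u : C(G, ℝ)} (hu : u ∈ translationFinite G) (x : G) :
    leftDeriv δ u x = δ (lTrans x u) := by
  have hu' : IsTranslationFinite u := hu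
  rw [leftDeriv, dif_pos hu']
  have h := (hu'.exists_lTrans_eq_sum).choose_spec.choose_spec.2 x
  rw [h, map_sum]
  simp [mul_comm]

/-- `(rightDeriv δ u)(x) = δ(u(· x))`. [folklore] -/
theorem rightDeriv_apply {u : C(G, ℝ)} (hu : u ∈ translationFinite G) (x : G) :
    rightDeriv δ u x = δ (rTrans x u) := by
  have hu' : IsTranslationFinite u := hu
  rw [rightDeriv, dif_pos hu']
  have h := (hu'.exists_rTrans_eq_sum).choose_spec.choose_spec.2 x
  rw [h, map_sum]
  simp [mul_comm]

/-- `leftDeriv δ u ∈ biSpan u`. [folklore] -/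
theorem leftDeriv_mem_biSpan {u : C(G, ℝ)} (hu : u ∈ translationFinite G) :
    leftDeriv δ u ∈ biSpan u := by
  have hu' : IsTranslationFinite u := hu
  rw [leftDeriv, dif_pos hu']
  refine Submodule.sum_mem _ fun y _ => Submodule.smul_mem _ _ ?_
  simpa using lTrans_rTrans_self_mem_biSpan u 1 y

/-- `rightDeriv δ u ∈ biSpan u`. [folklore] -/
theorem rightDeriv_mem_biSpan {u : C(G, ℝ)} (hu : u ∈ translationFinite G) :
    rightDeriv δ u ∈ biSpan u := by
  have hu' : IsTranslationFinite u := hu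
  rw [rightDeriv, dif_pos hu']
  exact Submodule.sum_mem _ fun y _ => Submodule.smul_mem _ _
    ((hu'.exists_rTrans_eq_sum).choose_spec.choose_spec.1 y)

/-- `leftDeriv δ u` is translation-finite. [folklore] -/
theorem leftDeriv_mem {u : C(G, ℝ)} (hu : u ∈ translationFinite G) :
    leftDeriv δ u ∈ translationFinite G :=
  biSpan_le_translationFinite hu (leftDeriv_mem_biSpan δ hu)

/-- `rightDeriv δ u` is translation-finite. [folklore] -/
theorem rightDeriv_mem {u : C(G, ℝ)} (hu : u ∈ translationFinite G) :
    rightDeriv δ u ∈ translationFinite G :=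
  biSpan_le_translationFinite hu (rightDeriv_mem_biSpan δ hu)

/-- `leftDeriv δ` maps `biSpan u` into itself. [folklore] -/
theorem leftDeriv_mem_biSpan_of_mem {u v : C(G, ℝ)} (hu : u ∈ translationFinite G)
    (hv : v ∈ biSpan u) : leftDeriv δ v ∈ biSpan u :=
  biSpan_le_of_mem hv (leftDeriv_mem_biSpan δ (biSpan_le_translationFinite hu hv))

/-- `rightDeriv δ` maps `biSpan u` into itself. [folklore] -/
theorem rightDeriv_mem_biSpan_of_mem {u v : C(G, ℝ)} (hu : u ∈ translationFinite G)
    (hv : v ∈ biSpan u) : rightDeriv δ v ∈ biSpan u :=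
  biSpan_le_of_mem hv (rightDeriv_mem_biSpan δ (biSpan_le_translationFinite hu hv))

/-- Additivity of `leftDeriv δ` on `R`. [folklore] -/
theorem leftDeriv_add {u v : C(G, ℝ)} (hu : u ∈ translationFinite G) (hv : v ∈ translationFinite G) :
    leftDeriv δ (u + v) = leftDeriv δ u + leftDeriv δ v := by
  ext x
  rw [ContinuousMap.add_apply, leftDeriv_apply δ hu, leftDeriv_apply δ hv,
    leftDeriv_apply δ ((translationFinite G).add_mem hu hv), map_add, map_add]

/-- Homogeneity of `leftDeriv δ` on `R`. [folklore] -/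
theorem leftDeriv_smul (c : ℝ) {u : C(G, ℝ)} (hu : u ∈ translationFinite G) :
    leftDeriv δ (c • u) = c • leftDeriv δ u := by
  ext x
  rw [ContinuousMap.smul_apply, leftDeriv_apply δ hu,
    leftDeriv_apply δ ((translationFinite G).smul_mem hu c), map_smul, map_smul]

/-- Additivity of `rightDeriv δ` on `R`. [folklore] -/
theorem rightDeriv_add {u v : C(G, ℝ)} (hu : u ∈ translationFinite G) (hv : v ∈ translationFinite G) :
    rightDeriv δ (u + v) = rightDeriv δ u + rightDeriv δ v := by
  ext x
  rw [ContinuousMap.add_apply, rightDeriv_apply δ hu, rightDeriv_apply δ hv,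
    rightDeriv_apply δ ((translationFinite G).add_mem hu hv), map_add, map_add]

/-- Homogeneity of `rightDeriv δ` on `R`. [folklore] -/
theorem rightDeriv_smul (c : ℝ) {u : C(G, ℝ)} (hu : u ∈ translationFinite G) :
    rightDeriv δ (c • u) = c • rightDeriv δ u := by
  ext x
  rw [ContinuousMap.smul_apply, rightDeriv_apply δ hu,
    rightDeriv_apply δ ((translationFinite G).smul_mem hu c), map_smul, map_smul]

/-- `leftDeriv δ` is linear in `δ`. [folklore] -/
theorem leftDeriv_add_left (δ₁ δ₂ : C(G, ℝ) →ₗ[ℝ] ℝ) {u : C(G, ℝ)} (hu : u ∈ translationFinite G) :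
    leftDeriv (δ₁ + δ₂) u = leftDeriv δ₁ u + leftDeriv δ₂ u := by
  ext x
  rw [ContinuousMap.add_apply, leftDeriv_apply _ hu, leftDeriv_apply _ hu, leftDeriv_apply _ hu,
    LinearMap.add_apply]

/-- `leftDeriv δ` is homogeneous in `δ`. [folklore] -/
theorem leftDeriv_smul_left (c : ℝ) {u : C(G, ℝ)} (hu : u ∈ translationFinite G) :
    leftDeriv (c • δ) u = c • leftDeriv δ u := by
  ext x
  rw [ContinuousMap.smul_apply, leftDeriv_apply _ hu, leftDeriv_apply _ hu, LinearMap.smul_apply]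

/-- Value at the identity: `(leftDeriv δ u)(1) = δ u`. [folklore] -/
theorem leftDeriv_apply_one {u : C(G, ℝ)} (hu : u ∈ translationFinite G) : leftDeriv δ u 1 = δ u := by
  rw [leftDeriv_apply δ hu, lTrans_one]

/-- Value at the identity: `(rightDeriv δ u)(1) = δ u`. [folklore] -/
theorem rightDeriv_apply_one {u : C(G, ℝ)} (hu : u ∈ translationFinite G) : rightDeriv δ u 1 = δ u := by
  rw [rightDeriv_apply δ hu, rTrans_one]

/-- **Left invariance**: `leftDeriv δ (u(g ·)) = (leftDeriv δ u)(g ·)`. [folklore] -/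
theorem leftDeriv_lTrans (g : G) {u : C(G, ℝ)} (hu : u ∈ translationFinite G) :
    leftDeriv δ (lTrans g u) = lTrans g (leftDeriv δ u) := by
  ext x
  rw [leftDeriv_apply δ (lTrans_mem_translationFinite hu g), lTrans_apply, leftDeriv_apply δ hu,
    lTrans_lTrans]

/-- **Right invariance** of `rightDeriv`: `rightDeriv δ (u(· g)) = (rightDeriv δ u)(· g)`. [folklore] -/
theorem rightDeriv_rTrans (g : G) {u : C(G, ℝ)} (hu : u ∈ translationFinite G) :
    rightDeriv δ (rTrans g u) = rTrans g (rightDeriv δ u) := by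
  ext x
  rw [rightDeriv_apply δ (rTrans_mem_translationFinite hu g), rTrans_apply, rightDeriv_apply δ hu,
    rTrans_rTrans]

/-- `leftDeriv` commutes with right translations up to the obvious twist:
`leftDeriv δ (rTrans g u) = rTrans g (leftDeriv δ' u)` is *false* in general; what holds is that
`leftDeriv δ` commutes with `rTrans g` composed … — we only record the true and useful identity
`leftDeriv δ (rTrans g u) (x) = δ (rTrans g (lTrans x u))`. [folklore] -/
theorem leftDeriv_rTrans_apply (g : G) {u : C(G, ℝ)} (hu : u ∈ translationFinite G) (x : G) :
    leftDeriv δ (rTrans g u) x = δ (rTrans g (lTrans x u)) := by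
  rw [leftDeriv_apply δ (rTrans_mem_translationFinite hu g), lTrans_rTrans]

/-- **Leibniz rule** for the left-invariant derivation of a point derivation:
`leftDeriv δ (uv) = (leftDeriv δ u) v + u (leftDeriv δ v)`. [folklore] -/
theorem IsPointDerivation.leftDeriv_mul {δ : C(G, ℝ) →ₗ[ℝ] ℝ} (hδ : IsPointDerivation δ)
    {u v : C(G, ℝ)} (hu : u ∈ translationFinite G) (hv : v ∈ translationFinite G) :
    leftDeriv δ (u * v) = leftDeriv δ u * v + u * leftDeriv δ v := by
  ext x
  rw [leftDeriv_apply δ ((translationFinite G).mul_mem hu hv), map_mul,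
    hδ _ (lTrans_mem_translationFinite hu x) _ (lTrans_mem_translationFinite hv x)]
  simp only [ContinuousMap.add_apply, ContinuousMap.mul_apply, lTrans_apply, mul_one,
    leftDeriv_apply δ hu, leftDeriv_apply δ hv]
  ring

/-- **Leibniz rule** for the right-invariant derivation of a point derivation. [folklore] -/
theorem IsPointDerivation.rightDeriv_mul {δ : C(G, ℝ) →ₗ[ℝ] ℝ} (hδ : IsPointDerivation δ)
    {u v : C(G, ℝ)} (hu : u ∈ translationFinite G) (hv : v ∈ translationFinite G) :
    rightDeriv δ (u * v) = rightDeriv δ u * v + u * rightDeriv δ v := by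
  ext x
  rw [rightDeriv_apply δ ((translationFinite G).mul_mem hu hv), map_mul,
    hδ _ (rTrans_mem_translationFinite hu x) _ (rTrans_mem_translationFinite hv x)]
  simp only [ContinuousMap.add_apply, ContinuousMap.mul_apply, rTrans_apply, one_mul,
    rightDeriv_apply δ hu, rightDeriv_apply δ hv]
  ring

/-- A point derivation kills constants, so `leftDeriv δ 1 = 0`. [folklore] -/
theorem IsPointDerivation.leftDeriv_one {δ : C(G, ℝ) →ₗ[ℝ] ℝ} (hδ : IsPointDerivation δ) :
    leftDeriv δ (1 : C(G, ℝ)) = 0 := by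
  ext x
  rw [leftDeriv_apply δ (translationFinite G).one_mem, map_one, hδ.apply_one]; rfl

/-- **Inversion exchanges left and right derivations** (for a point derivation, `δ(ǔ) = -δ(u)`):
`(rightDeriv δ u)(x) = -(leftDeriv δ ǔ)(x⁻¹)`, i.e. `rightDeriv δ u = -(leftDeriv δ ǔ)ˇ`. [folklore] -/
theorem IsPointDerivation.rightDeriv_eq {δ : C(G, ℝ) →ₗ[ℝ] ℝ} (hδ : IsPointDerivation δ)
    {u : C(G, ℝ)} (hu : u ∈ translationFinite G) :
    rightDeriv δ u = -invTrans (leftDeriv δ (invTrans u)) := by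
  ext x
  have hSu := invTrans_mem_translationFinite hu
  rw [rightDeriv_apply δ hu, ContinuousMap.neg_apply, invTrans_apply, leftDeriv_apply δ hSu]
  have : lTrans x⁻¹ (invTrans u) = invTrans (rTrans x u) := by
    ext y; simp [mul_inv_rev]
  rw [this, hδ.apply_invTrans (rTrans_mem_translationFinite hu x), neg_neg]

/-! ### The Fubini identity and commuting left/right derivations -/

/-- **Fubini for functionals**: `δ₂ (x ↦ δ₁(u(· x))) = δ₁ (y ↦ δ₂(u(y ·)))` for any two linear
functionals and translation-finite `u`: with `u(yx) = Σ u(y yᵢ) wᵢ(x)` both sides equal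
`Σ δ₁(u(· yᵢ)) δ₂(wᵢ)`. [folklore] -/
theorem apply_rightDeriv_eq_apply_leftDeriv (δ₁ δ₂ : C(G, ℝ) →ₗ[ℝ] ℝ) {u : C(G, ℝ)}
    (hu : u ∈ translationFinite G) : δ₂ (rightDeriv δ₁ u) = δ₁ (leftDeriv δ₂ u) := by
  obtain ⟨s, w, hw, h⟩ := IsTranslationFinite.exists_expansion hu
  -- `rTrans x u = Σ wᵢ(x) • rTrans yᵢ u` and `lTrans y u = Σ (rTrans yᵢ u)(y) • wᵢ`
  have hr : ∀ x, rTrans x u = ∑ y ∈ s, (w y x) • rTrans y u := fun x => by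
    ext z; simp [h z x, mul_comm]
  have hl : ∀ x, lTrans x u = ∑ y ∈ s, (rTrans y u x) • w y := fun x => by
    ext z; simp [h x z]
  have h1 : rightDeriv δ₁ u = ∑ y ∈ s, δ₁ (rTrans y u) • w y := by
    ext x
    rw [rightDeriv_apply δ₁ hu, hr x, map_sum]
    simp [mul_comm]
  have h2 : leftDeriv δ₂ u = ∑ y ∈ s, δ₂ (w y) • rTrans y u := by
    ext x
    rw [leftDeriv_apply δ₂ hu, hl x, map_sum]
    simp [mul_comm]
  rw [h1, h2, map_sum, map_sum]
  simp [mul_comm]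

/-- `leftDeriv (δ ∘ lTrans x) u = (leftDeriv δ u)(· x)`. [folklore] -/
theorem leftDeriv_comp_lTrans (x : G) {u : C(G, ℝ)} (hu : u ∈ translationFinite G) :
    leftDeriv (δ.comp (lTrans x).toLinearMap) u = rTrans x (leftDeriv δ u) := by
  ext z
  rw [leftDeriv_apply _ hu, rTrans_apply, leftDeriv_apply δ hu, LinearMap.comp_apply,
    AlgHom.toLinearMap_apply, lTrans_lTrans]

/-- **Left and right derivations commute**: `leftDeriv δ₁ (rightDeriv δ₂ u) = rightDeriv δ₂ (leftDeriv δ₁ u)`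
(both equal `x ↦ (δ₂ ⊗ δ₁)(u(· x ·))`, by the Fubini identity applied to `δ₂` and `δ₁ ∘ lTrans x`).
[folklore] -/
theorem leftDeriv_rightDeriv_comm (δ₁ δ₂ : C(G, ℝ) →ₗ[ℝ] ℝ) {u : C(G, ℝ)}
    (hu : u ∈ translationFinite G) :
    leftDeriv δ₁ (rightDeriv δ₂ u) = rightDeriv δ₂ (leftDeriv δ₁ u) := by
  ext x
  rw [leftDeriv_apply δ₁ (rightDeriv_mem δ₂ hu), rightDeriv_apply δ₂ (leftDeriv_mem δ₁ hu)]
  have h1 : δ₁ (lTrans x (rightDeriv δ₂ u)) = (δ₁.comp (lTrans x).toLinearMap) (rightDeriv δ₂ u) := rfl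
  rw [h1, apply_rightDeriv_eq_apply_leftDeriv δ₂ _ hu, leftDeriv_comp_lTrans δ₁ x hu]

/-! ### The bracket of two point derivations -/

/-- The bracket of two functionals as a function on `C(G, ℝ)`:
`⁅δ₁, δ₂⁆(u) = δ₁ (leftDeriv δ₂ u) - δ₂ (leftDeriv δ₁ u)` (meaningful on translation-finite `u`). [folklore] -/
def bracketFun (δ₁ δ₂ : C(G, ℝ) →ₗ[ℝ] ℝ) (u : C(G, ℝ)) : ℝ :=
  δ₁ (leftDeriv δ₂ u) - δ₂ (leftDeriv δ₁ u)

/-- The bracket as a linear functional on `R = translationFinite G`. [folklore] -/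
def bracketR (δ₁ δ₂ : C(G, ℝ) →ₗ[ℝ] ℝ) :
    Subalgebra.toSubmodule (translationFinite G) →ₗ[ℝ] ℝ where
  toFun u := bracketFun δ₁ δ₂ u
  map_add' u v := by
    simp only [bracketFun, Submodule.coe_add, leftDeriv_add _ u.2 v.2, map_add]; ring
  map_smul' c u := by
    simp only [bracketFun, Submodule.coe_smul, leftDeriv_smul _ c u.2, map_smul, smul_eq_mul,
      RingHom.id_apply]; ring

/-- **The bracket `⁅δ₁, δ₂⁆` of two functionals** as a linear functional on `C(G, ℝ)` (a linear
extension from `R`; only its values on `R`, given by `bracket_apply`, matter). For point derivations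
this is the Lie bracket of tangent vectors at `1` (Hochschild 1965, II §3). [folklore] -/
def bracket (δ₁ δ₂ : C(G, ℝ) →ₗ[ℝ] ℝ) : C(G, ℝ) →ₗ[ℝ] ℝ :=
  Classical.choose (LinearMap.exists_extend (bracketR δ₁ δ₂))

/-- `⁅δ₁, δ₂⁆(u) = δ₁ (leftDeriv δ₂ u) - δ₂ (leftDeriv δ₁ u)` for `u ∈ R`. [folklore] -/
theorem bracket_apply (δ₁ δ₂ : C(G, ℝ) →ₗ[ℝ] ℝ) {u : C(G, ℝ)} (hu : u ∈ translationFinite G) :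
    bracket δ₁ δ₂ u = δ₁ (leftDeriv δ₂ u) - δ₂ (leftDeriv δ₁ u) := by
  have h := Classical.choose_spec (LinearMap.exists_extend (bracketR δ₁ δ₂))
  have := LinearMap.congr_fun h ⟨u, hu⟩
  simpa [bracket, bracketR, bracketFun] using this

/-- `⁅δ₂, δ₁⁆ = -⁅δ₁, δ₂⁆` on `R`. [folklore] -/
theorem bracket_swap (δ₁ δ₂ : C(G, ℝ) →ₗ[ℝ] ℝ) {u : C(G, ℝ)} (hu : u ∈ translationFinite G) :
    bracket δ₂ δ₁ u = -bracket δ₁ δ₂ u := by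
  rw [bracket_apply _ _ hu, bracket_apply _ _ hu]; ring

/-- **The bracket of two point derivations is a point derivation.** [folklore] -/
theorem IsPointDerivation.bracket {δ₁ δ₂ : C(G, ℝ) →ₗ[ℝ] ℝ} (h₁ : IsPointDerivation δ₁)
    (h₂ : IsPointDerivation δ₂) : IsPointDerivation (bracket δ₁ δ₂) := by
  intro u hu v hv
  rw [bracket_apply _ _ ((translationFinite G).mul_mem hu hv), bracket_apply _ _ hu,
    bracket_apply _ _ hv, h₂.leftDeriv_mul hu hv, h₁.leftDeriv_mul hu hv, map_add, map_add,
    h₁ _ (leftDeriv_mem δ₂ hu) _ hv, h₁ _ hu _ (leftDeriv_mem δ₂ hv),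
    h₂ _ (leftDeriv_mem δ₁ hu) _ hv, h₂ _ hu _ (leftDeriv_mem δ₁ hv),
    leftDeriv_apply_one _ hu, leftDeriv_apply_one _ hv, leftDeriv_apply_one _ hu,
    leftDeriv_apply_one _ hv]
  ring

/-- **`leftDeriv` of the bracket is the commutator**:
`leftDeriv ⁅δ₁, δ₂⁆ u = leftDeriv δ₁ (leftDeriv δ₂ u) - leftDeriv δ₂ (leftDeriv δ₁ u)` on `R`
(left invariance). [folklore] -/
theorem leftDeriv_bracket (δ₁ δ₂ : C(G, ℝ) →ₗ[ℝ] ℝ) {u : C(G, ℝ)} (hu : u ∈ translationFinite G) :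
    leftDeriv (bracket δ₁ δ₂) u = leftDeriv δ₁ (leftDeriv δ₂ u) - leftDeriv δ₂ (leftDeriv δ₁ u) := by
  ext x
  rw [leftDeriv_apply _ hu, bracket_apply _ _ (lTrans_mem_translationFinite hu x),
    ContinuousMap.sub_apply, leftDeriv_apply δ₁ (leftDeriv_mem δ₂ hu),
    leftDeriv_apply δ₂ (leftDeriv_mem δ₁ hu), leftDeriv_lTrans δ₂ x hu, leftDeriv_lTrans δ₁ x hu]

/-- The bracket in terms of right derivations: `⁅δ₁, δ₂⁆(u) = δ₂ (rightDeriv δ₁ u) - δ₂ (leftDeriv δ₁ u)`,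
i.e. `⁅δ₁, δ₂⁆ = δ₂ ∘ (rightDeriv δ₁ - leftDeriv δ₁)` on `R` (Fubini). This is the form in which the
bracket appears when differentiating the conjugation action. [folklore] -/
theorem bracket_eq_apply_rightDeriv_sub (δ₁ δ₂ : C(G, ℝ) →ₗ[ℝ] ℝ) {u : C(G, ℝ)}
    (hu : u ∈ translationFinite G) :
    bracket δ₁ δ₂ u = δ₂ (rightDeriv δ₁ u) - δ₂ (leftDeriv δ₁ u) := by
  rw [bracket_apply _ _ hu, apply_rightDeriv_eq_apply_leftDeriv δ₁ δ₂ hu]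

end Literature.RepresentationTheory.CompactGroups
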